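import Mathlib.Analysis.SpecialFunctions.Integrals.Basic
import Mathlib.MeasureTheory.Integral.Pi
import Summits.KontsevichZagierPeriods.KontsevichZagierPeriods.Theorems.ValuedFieldSpecialisationClassLevelExpansionFibreDimOneElementaryB
import Literature.NumberTheory.Transcendental.KZConstantTerm
import Literature.NumberTheory.Transcendental.KZProduct

/-!
# Route ValuedFieldSpecialisation — slice values of the elementary divergent products

Helper for the crux `CTConstruction` (stmt-KontsevichZagierPeriods-3495, line `registered`, stub
`stub_elementarySliceValue`). The elementary divergent product `P = P(p, q, b, d, r)` of the route
(file `ValuedFieldSpecialisationDefs`, `elementaryGenerators`) lives in coordinates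
`z = (s, u, y₁ … y_b, w₁ … w_d) = vecCons s (vecCons u (Fin.append y w))` on the domain
`0 < s < 1`, `0 < u`, `u ^ q * s ^ p < 1`, `s ≤ y_j ≤ 1`, `w ∈ r.domain`, with integrand
`(∏_j y_j⁻¹) · r.integrand w`. Its slice over `s ∈ (0, 1)` (`KZ.sliceValue P s`, file
`KZConstantTerm`) is the set `{(u, y, w) | 0 < u < s ^ (-p/q), y ∈ [s, 1]ᵇ, w ∈ r.domain}` and by
Fubini–Tonelli the slice integral factors as
`(∫_0^{s^(-p/q)} du) · (∫_s^1 dy / y)ᵇ · ∫_{r.domain} r.integrand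
  = s ^ (-p/q) · (-log s)ᵇ · r.value = (-1)ᵇ · r.value · s ^ (-p/q) · (log s)ᵇ`:
EXACTLY one divergent log-power monomial (`sliceValue_elementary`, `stub_elementarySliceValue`).

The computation peels the coordinate `u` with the measure-preserving map `(t, x) ↦ vecCons t x`
(`KZ.integral_comp_vecCons`) and splits `(y, w)` with `KZ.appendMeasurableEquiv`; the product
formulas `MeasureTheory.integral_prod_mul`, `MeasureTheory.integral_fintype_prod_volume_eq_pow`
need no integrability hypotheses, so neither does the computation.

Sources: M. Kontsevich, D. Zagier, *Periods* (2001), §1.1–1.2 (families of integrals, Fubini);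
G. Comte, J.-M. Lion, J.-P. Rolin, Illinois J. Math. 44 (2000), Thm. 1 (the log-power monomials
these products realise). The encoding is this route's.
-/

noncomputable section

namespace Summit.KontsevichZagierPeriods.ValuedFieldSpecialisation

open MeasureTheory Set Filter
open scoped Topology
open Literature.NumberTheory.Transcendental Literature.NumberTheory.Transcendental.KZ

/-! ### Fubini for separable products in `Fin`-coordinates (no integrability needed) -/

/-- **Fubini along `vecCons`**: `∫ z, f (z 0) · Θ (tail z) = (∫ f) · (∫ Θ)` on `ℝᵐ⁺¹`, with no
integrability hypothesis (both sides vanish when a factor is not integrable). [folklore] -/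
theorem integral_cons_mul_eq {m : ℕ} (f : ℝ → ℝ) (Θ : (Fin m → ℝ) → ℝ) :
    ∫ z : Fin (m + 1) → ℝ, f (z 0) * Θ (fun i => z i.succ) = (∫ t, f t) * ∫ x, Θ x := by
  have h := integral_comp_vecCons (n := m) (fun z => f (z 0) * Θ (fun i => z i.succ))
  simp only [Matrix.cons_val_zero, Matrix.cons_val_succ] at h
  rw [← h]
  exact integral_prod_mul f Θ

/-- **Fubini along `Fin.append`**: `∫ x, Θ₁ (x|_b) · Θ₂ (x|^d) = (∫ Θ₁) · (∫ Θ₂)` on `ℝᵇ⁺ᵈ`, with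
no integrability hypothesis. [folklore] -/
theorem integral_append_mul_eq {b d : ℕ} (Θ₁ : (Fin b → ℝ) → ℝ) (Θ₂ : (Fin d → ℝ) → ℝ) :
    ∫ x : Fin (b + d) → ℝ, Θ₁ (fun j => x (Fin.castAdd d j)) * Θ₂ (fun l => x (Fin.natAdd b l)) =
      (∫ y, Θ₁ y) * ∫ w, Θ₂ w := by
  rw [← (volume_preserving_appendMeasurableEquiv (n := b) (m := d)).integral_comp']
  simp only [appendMeasurableEquiv_apply, Fin.append_left, Fin.append_right]
  rw [Measure.volume_eq_prod]
  exact integral_prod_mul Θ₁ Θ₂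

/-! ### One-variable factors -/

/-- On the padded domain `u ^ q * s ^ p < 1 ↔ u < s ^ (-p/q)` (`0 < s`, `0 < q`, `0 ≤ u`).
[folklore] -/
theorem pow_mul_pow_lt_one_iff_lt_rpow {s u : ℝ} (hs : 0 < s) (hu : 0 ≤ u) {p q : ℕ}
    (hq : 0 < q) : u ^ q * s ^ p < 1 ↔ u < s ^ (-(p : ℝ) / q) := by
  refine ⟨lt_rpow_neg_div_of_pow_mul_pow_lt_one hs hq, fun h => ?_⟩
  have hq0 : (q : ℝ) ≠ 0 := by exact_mod_cast hq.ne'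
  have key : (s ^ (-(p : ℝ) / q)) ^ q * s ^ p = 1 := by
    rw [← Real.rpow_natCast (s ^ (-(p : ℝ) / q)) q, ← Real.rpow_mul hs.le,
      div_mul_cancel₀ _ hq0, Real.rpow_neg hs.le, Real.rpow_natCast,
      inv_mul_cancel₀ (pow_ne_zero _ hs.ne')]
  calc u ^ q * s ^ p < (s ^ (-(p : ℝ) / q)) ^ q * s ^ p :=
        mul_lt_mul_of_pos_right (pow_lt_pow_left₀ h hu hq.ne') (pow_pos hs p)
    _ = 1 := key

/-- `∫ 𝟙_(0, a) = a` for `0 ≤ a`. [folklore] -/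
theorem integral_indicator_Ioo_one {a : ℝ} (ha : 0 ≤ a) :
    ∫ t, (Ioo 0 a).indicator (fun _ => (1 : ℝ)) t = a := by
  rw [integral_indicator_const (1 : ℝ) measurableSet_Ioo, smul_eq_mul, mul_one,
    Real.volume_real_Ioo_of_le ha, sub_zero]

/-- `∫ 𝟙_[s, 1](y) y⁻¹ dy = -log s` for `0 < s ≤ 1`. [folklore] -/
theorem integral_indicator_Icc_inv {s : ℝ} (hs : 0 < s) (hs1 : s ≤ 1) :
    ∫ t, (Icc s 1).indicator (fun y => y⁻¹) t = -Real.log s := by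
  rw [integral_indicator measurableSet_Icc, integral_Icc_eq_integral_Ioc,
    ← intervalIntegral.integral_of_le hs1, integral_inv_of_pos hs one_pos, one_div, Real.log_inv]

/-! ### The slice values -/

variable {d : ℕ}

/-- **Slices of an elementary divergent product.** For `P = P(p, q, b, d, r)` (domain and
integrand as in the route's `elementaryGenerators`, `0 < q`) and `s ∈ (0, 1)`:
`sliceValue P s = s ^ (-p/q) · (-log s)ᵇ · r.value` — Fubini over `u ∈ (0, s ^ (-p/q))`,
`y ∈ [s, 1]ᵇ`, `w ∈ r.domain`. [Kontsevich–Zagier 2001, §1.2] [folklore] -/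
theorem sliceValue_elementary {p q b : ℕ} (r : IntegralRep d) (P : IntegralRep (b + d + 1 + 1))
    (hq : 0 < q)
    (hdom : P.domain = {z | ∃ (s u : ℝ) (y : Fin b → ℝ) (w : Fin d → ℝ),
      z = Matrix.vecCons s (Matrix.vecCons u (Fin.append y w)) ∧ 0 < s ∧ s < 1 ∧ 0 < u ∧
        u ^ q * s ^ p < 1 ∧ (∀ j, s ≤ y j ∧ y j ≤ 1) ∧ w ∈ r.domain})
    (hint : P.integrand = fun z => (∏ j : Fin b, (z (Fin.castAdd d j).succ.succ)⁻¹) *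
      r.integrand (fun l : Fin d => z (Fin.natAdd b l).succ.succ))
    {s : ℝ} (hs : s ∈ Ioo (0 : ℝ) 1) :
    sliceValue P s = s ^ (-(p : ℝ) / q) * (-Real.log s) ^ b * r.value := by
  obtain ⟨hs0, hs1⟩ := hs
  -- the three separable factors of the slice integrand extended by zero
  obtain ⟨a, ha⟩ : ∃ a : ℝ, a = s ^ (-(p : ℝ) / q) := ⟨_, rfl⟩
  obtain ⟨f, hf⟩ : ∃ f : ℝ → ℝ, f = (Ioo 0 a).indicator fun _ => (1 : ℝ) := ⟨_, rfl⟩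
  obtain ⟨g, hg⟩ : ∃ g : ℝ → ℝ, g = (Icc s 1).indicator fun y => y⁻¹ := ⟨_, rfl⟩
  obtain ⟨h, hh⟩ : ∃ h : (Fin d → ℝ) → ℝ, h = r.domain.indicator r.integrand := ⟨_, rfl⟩
  have key : {x : Fin (b + d + 1) → ℝ | Matrix.vecCons s x ∈ P.domain}.indicator
        (fun x => P.integrand (Matrix.vecCons s x)) =
      fun x => f (x 0) * ((∏ j : Fin b, g (x (Fin.castAdd d j).succ)) *
        h (fun l : Fin d => x (Fin.natAdd b l).succ)) := by
    funext x
    have hmem : x ∈ {x : Fin (b + d + 1) → ℝ | Matrix.vecCons s x ∈ P.domain} ↔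
        (0 < x 0 ∧ x 0 ^ q * s ^ p < 1) ∧
        (∀ j : Fin b, s ≤ x (Fin.castAdd d j).succ ∧ x (Fin.castAdd d j).succ ≤ 1) ∧
        (fun l : Fin d => x (Fin.natAdd b l).succ) ∈ r.domain := by
      rw [hdom, elementaryDomain_eq]
      simp only [mem_setOf_eq, Matrix.cons_val_zero, Matrix.cons_val_one, Matrix.cons_val_succ]
      tauto
    have hPx : P.integrand (Matrix.vecCons s x) = (∏ j : Fin b, (x (Fin.castAdd d j).succ)⁻¹) *
        r.integrand (fun l : Fin d => x (Fin.natAdd b l).succ) := by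
      rw [hint]
      simp only [Matrix.cons_val_succ]
    by_cases hu : 0 < x 0 ∧ x 0 ^ q * s ^ p < 1
    · have h1 : f (x 0) = 1 := by
        rw [hf, indicator_of_mem]
        exact ⟨hu.1, by rw [ha]; exact (pow_mul_pow_lt_one_iff_lt_rpow hs0 hu.1.le hq).mp hu.2⟩
      by_cases hy : ∀ j : Fin b, s ≤ x (Fin.castAdd d j).succ ∧ x (Fin.castAdd d j).succ ≤ 1
      · have h2 : ∀ j : Fin b, g (x (Fin.castAdd d j).succ) = (x (Fin.castAdd d j).succ)⁻¹ :=
          fun j => by rw [hg, indicator_of_mem (show x (Fin.castAdd d j).succ ∈ Icc s 1 from hy j)]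
        by_cases hw : (fun l : Fin d => x (Fin.natAdd b l).succ) ∈ r.domain
        · have h3 : h (fun l : Fin d => x (Fin.natAdd b l).succ) =
              r.integrand (fun l : Fin d => x (Fin.natAdd b l).succ) := by
            rw [hh, indicator_of_mem hw]
          rw [indicator_of_mem (hmem.mpr ⟨hu, hy, hw⟩), hPx]
          simp only [h1, h2, h3, one_mul]
        · have h3 : h (fun l : Fin d => x (Fin.natAdd b l).succ) = 0 := by
            rw [hh, indicator_of_notMem hw]
          rw [indicator_of_notMem (fun hx => hw (hmem.mp hx).2.2)]
          simp only [h3, mul_zero]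
      · obtain ⟨j, hj⟩ := not_forall.mp hy
        have h2 : g (x (Fin.castAdd d j).succ) = 0 := by
          rw [hg, indicator_of_notMem (show x (Fin.castAdd d j).succ ∉ Icc s 1 from hj)]
        have h2' : ∏ j : Fin b, g (x (Fin.castAdd d j).succ) = 0 :=
          Finset.prod_eq_zero (Finset.mem_univ j) h2
        rw [indicator_of_notMem (fun hx => hy (hmem.mp hx).2.1)]
        simp only [h2', zero_mul, mul_zero]
    · have h1 : f (x 0) = 0 := by
        rw [hf, indicator_of_notMem]
        rintro ⟨h0, h0a⟩
        rw [ha] at h0a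
        exact hu ⟨h0, (pow_mul_pow_lt_one_iff_lt_rpow hs0 h0.le hq).mpr h0a⟩
      rw [indicator_of_notMem (fun hx => hu (hmem.mp hx).1), h1, zero_mul]
  -- the three one-group integrals
  have hF : ∫ t, f t = a := by
    rw [hf]
    exact integral_indicator_Ioo_one (by rw [ha]; exact Real.rpow_nonneg hs0.le _)
  have hG : ∫ y : Fin b → ℝ, ∏ j, g (y j) = (-Real.log s) ^ b := by
    rw [integral_fintype_prod_volume_eq_pow, Fintype.card_fin, hg,
      integral_indicator_Icc_inv hs0 hs1.le]
  have hH : ∫ w, h w = r.value := by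
    rw [hh, integral_indicator (IntegralRep.measurableSet_domain_holds r)]
    rfl
  -- Fubini
  have step1 : ∫ x : Fin (b + d + 1) → ℝ, f (x 0) * ((∏ j : Fin b, g (x (Fin.castAdd d j).succ)) *
        h (fun l : Fin d => x (Fin.natAdd b l).succ)) =
      (∫ t, f t) * ∫ x : Fin (b + d) → ℝ, (∏ j : Fin b, g (x (Fin.castAdd d j))) *
        h (fun l : Fin d => x (Fin.natAdd b l)) :=
    integral_cons_mul_eq f (fun x => (∏ j : Fin b, g (x (Fin.castAdd d j))) *
      h (fun l : Fin d => x (Fin.natAdd b l)))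
  have step2 : ∫ x : Fin (b + d) → ℝ, (∏ j : Fin b, g (x (Fin.castAdd d j))) *
        h (fun l : Fin d => x (Fin.natAdd b l)) = (∫ y : Fin b → ℝ, ∏ j, g (y j)) * ∫ w, h w :=
    integral_append_mul_eq (fun y : Fin b → ℝ => ∏ j, g (y j)) h
  rw [sliceValue_def, ← integral_indicator (measurableSet_slice P s), key, step1, step2, hF, hG,
    hH, ha]
  ring

/-- **Stub `stub_elementarySliceValue` of the crux `CTConstruction`** (stmt-KontsevichZagierPeriods-3495,
line `registered`): the slice over `s ∈ (0, 1)` of an elementary divergent product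
`P(p, q, b, d, r)` of the route is EXACTLY the divergent monomial
`(-1)ᵇ · r.value · s ^ (-p/q) · (log s)ᵇ` (`sliceValue_elementary`, rewritten).
[Kontsevich–Zagier 2001, §1.2] [folklore] -/
theorem stub_elementarySliceValue : ∀ (p q b d : ℕ) (r : Literature.NumberTheory.Transcendental.KZ.IntegralRep d) (P : Literature.NumberTheory.Transcendental.KZ.IntegralRep (b + d + 1 + 1)), 0 < q → P.domain = {z | ∃ (s u : ℝ) (y : Fin b → ℝ) (w : Fin d → ℝ), z = Matrix.vecCons s (Matrix.vecCons u (Fin.append y w)) ∧ 0 < s ∧ s < 1 ∧ 0 < u ∧ u ^ q * s ^ p < 1 ∧ (∀ j, s ≤ y j ∧ y j ≤ 1) ∧ w ∈ r.domain} → P.integrand = (fun z => (∏ j : Fin b, (z (Fin.castAdd d j).succ.succ)⁻¹) * r.integrand (fun l : Fin d => z (Fin.natAdd b l).succ.succ)) → ∀ s ∈ Set.Ioo (0 : ℝ) 1, Literature.NumberTheory.Transcendental.KZ.sliceValue P s = (-1) ^ b * r.value * s ^ (((-(p : ℚ) / q : ℚ)) : ℝ) * Real.log s ^ b := by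
  intro p q b d r P hq hdom hint s hs
  have hexp : (((-(p : ℚ) / q : ℚ)) : ℝ) = -(p : ℝ) / q := by
    push_cast
    ring
  rw [sliceValue_elementary r P hq hdom hint hs, hexp, neg_pow]
  ring

end Summit.KontsevichZagierPeriods.ValuedFieldSpecialisation
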